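import Summits.BirchSwinnertonDyer.BirchSwinnertonDyer.Theorems.GenusKolyvaginAtTwoMinimalTwinBSDTwoAnalyticSplit
import Summits.BirchSwinnertonDyer.BirchSwinnertonDyer.Theorems.GenusKolyvaginAtTwoMinimalTwinBSDTwoIdLocusIff
import Summits.BirchSwinnertonDyer.BirchSwinnertonDyer.Theses.ByReductionTypeAtTwo
import HarnessLib

/-!
# Route `GenusKolyvaginAtTwo`, crux U₂ `MinimalTwinBSDTwo` (stmt-BirchSwinnertonDyer-22985): the identity-component residual of LINE 23
# discharged onto the sibling route's item `RankOneAtTwoBigImageIdLocus` (stmt-BirchSwinnertonDyer-32821) BY NAME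

Seat `bsd-line-gk2-p3` g29 (PROVER seat 3/3, cell `bsd-f1-sign2`), `--supports stmt-BirchSwinnertonDyer-22985` (helper; closes nothing).
THEOREMS ONLY (no definition, no named fact, no `sorry`); standard axioms.  **BSD is NOT proved by this file; U₂ / item 32821 / the wall / NV / EXP
are NOT proved; no item is closed.**  CONDITIONAL on the displayed hypotheses exactly like this seat's ledgers p772295 / p773314 / p773745, of which it is
the BY-NAME form (director (548)(A): «ONE item, TWO routes — dedup by name, not by re-typed signature»): the binder `hSid` (signature text) is replaced by
the route decl `Summit.BirchSwinnertonDyer.BirchSwinnertonDyer.Theses.ByReductionTypeAtTwo.RankOneAtTwoBigImageIdLocus` (rendered at K4 rev 42).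

* `rankOneAtTwoBigImageIdLocus_iff_hTw0idSharp_of_GZK` — item 32821 ⟺ LINE 23's residual `hTw0^{id,♯}` (mod GZK), BY NAME.
* `nonCMAtTwo_of_items_of_slicedWall_of_reversedSuppliesEgg_of_rankOneAtTwoBigImageIdLocus_line25` — `closes` (rev 57) ⟸ items + S1⁺ + S1⁻ +
  S2″⁺ + S2⁻′ + **item 32821** + PRINT.
* `nonCMAtTwo_of_items_of_slicedWall_of_nonvanishing_of_exponent_of_rankOneAtTwoBigImageIdLocus_line25` — `closes` (rev 57) ⟸ items + S1⁺ + S1⁻ +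
  NV⁺ + EXP⁺ + NV⁻ + EXP⁻ + **item 32821** + PRINT (+ modular parametrisation).

References: [SilvermanAEC2009] X.4.2; [Kramer1981] §2 Props. 3, 6; [MazurRubin2010] Cor. 3.4 (i); [GrossZagier1986] V.§2 (2.2); [Miller2011LMS] Def. 1.1.
-/

set_option autoImplicit false
set_option linter.dupNamespace false -- `Summit.<P>.<Sub>` repeats `BirchSwinnertonDyer` (D-0017)

noncomputable section

open scoped Classical

open WeierstrassCurve NumberField Literature.NumberTheory.EllipticCurves
  Literature.NumberTheory.EllipticCurves.ModularForms
  Summit.BirchSwinnertonDyer.Rank1Residual.F1Sign2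
  Summit.BirchSwinnertonDyer.BirchSwinnertonDyer.Rank1Residual
  Summit.BirchSwinnertonDyer.BirchSwinnertonDyer.Theses.GenusKolyvaginAtTwo

open Summit.BirchSwinnertonDyer.BirchSwinnertonDyer.Theses.ByReductionTypeAtTwo (RankOneAtTwoBigImageIdLocus)

namespace Summit.BirchSwinnertonDyer.BirchSwinnertonDyer.Theorems.GenusExact.TwinSwap.Ledger.Line25

/-- **Item 32821 `RankOneAtTwoBigImageIdLocus` ⟺ LINE 23's residual `hTw0^{id,♯}` (mod GZK), BY NAME** — the route decl unfolds to the
`S_id` text of p773314's `hTw0idSharp_iff_idLocus_of_GZK` (definitionally).  CONDITIONAL on GZK; proves nothing about BSD; closes nothing.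
[cite: SilvermanAEC2009, X.4.2] [cite: Kolyvagin1989Izv, Thm. A] -/
theorem rankOneAtTwoBigImageIdLocus_iff_hTw0idSharp_of_GZK (hGZK : rank_eq_analyticRank_of_analyticRank_le_one) :
    RankOneAtTwoBigImageIdLocus ↔
    (∀ (W : WeierstrassCurve ℚ) [W.IsElliptic] [W.IsGloballyMinimal], ¬ W.HasCM → W.analyticRank = 1 →
      Nat.card (W.selmerGroup 2) = 2 → (∀ n : ℕ, W.HasSurjectiveModNGaloisRep ((2 ^ n : ℕ) : ℤ)) → 0 < W.Δ →
      padicValNat 2 W.tamagawaProduct = 0 → ¬ MeetsEgg W → BSDp W 2) :=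
  (hTw0idSharp_iff_idLocus_of_GZK hGZK).symm

/-- **`closes` (rev 57) ⟸ items + S1⁺ + S1⁻ + S2″⁺ + S2⁻′ + item 32821 + PRINT, BY NAME** — p772295's
`nonCMAtTwo_of_items_of_slicedWall_of_reversedSuppliesEgg_of_idLocus_line25` with `hSid := RankOneAtTwoBigImageIdLocus` (the route decl unfolds to the
binder text).  CONDITIONAL on the displayed hypotheses; proves nothing about BSD by itself; closes no item.
[cite: Kramer1981, §2 Props. 3, 6] [cite: MazurRubin2010, Cor. 3.4 (i)] [cite: GrossZagier1986, V.§2 (2.2)] [cite: Miller2011LMS, Def. 1.1] -/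
theorem nonCMAtTwo_of_items_of_slicedWall_of_reversedSuppliesEgg_of_rankOneAtTwoBigImageIdLocus_line25
    (hP : GenusPrimitiveSupplyAtTwoPosDiscShallow) (hPG : GenusDeepSupplyAtTwoNegDiscNarrow) (hQ1 : CyclicTorsionOfNegDisc)
    (hQ2 : KolyvaginRelationAtTwo)
    (hQ5R : EquivariantChebotarevAtTwoR) (hQ3RT : EquivariantKolyvaginExactAtTwoRT)
    (hQ4T : KolyvaginExactAtTwoPosDiscT) (hGf : ExactDescentAtTwoOfFourFacts)
    (hR : OffHabitatResidualAtTwo) (hOff : OffCutResidualAtTwoR)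
    (hK1P : K1Pos) (hK1N : K1Neg) (hSha1 : ShaVanishingAtDepthZeroAtTwo)
    (hS1pos : ∀ (W : WeierstrassCurve ℚ) [W.IsElliptic] [W.IsGloballyMinimal],
      ¬ W.HasCM → W.analyticRank = 0 → Nat.card (W.selmerGroup 2) = 1 → 0 < W.Δ → padicValNat 2 W.tamagawaProduct = 0 → BSDp W 2)
    (hS1neg : ∀ (W : WeierstrassCurve ℚ) [W.IsElliptic] [W.IsGloballyMinimal],
      ¬ W.HasCM → W.analyticRank = 0 → Nat.card (W.selmerGroup 2) = 1 → W.Δ < 0 → padicValNat 2 W.tamagawaProduct = 2 → BSDp W 2)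
    (hS2egg : ∀ (W : WeierstrassCurve ℚ) [W.IsElliptic] [W.IsGloballyMinimal] [NeZero (W.conductorNorm ℤ)],
      ¬ W.HasCM → W.analyticRank = 1 → Nat.card (W.selmerGroup 2) = 2 → Odd W.tamagawaProduct → (W.Δ < 0 ∨ MeetsEgg W) →
      ∃ (K : Type) (_ : Field K) (_ : NumberField K),
        IsImaginaryQuadratic K ∧ Odd (NumberField.discr K) ∧ NumberField.discr K ≠ -3 ∧ SatisfiesHeegnerHypothesis (W.conductorNorm ℤ) K ∧
        ∃ (Dt : ModularParametrizationData W (W.conductorNorm ℤ)) (β : ℤ) (ι : K →+* ℂ) (d₁ : KolyvaginHeegnerData Dt β ι 1),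
          Dt.c ≠ 0 ∧ ¬ IsOfFinAddOrder d₁.derivedPoint ∧
          (∃ M₀ : ℕ, padicValInt 2 Dt.c = M₀ ∧
            (∃ Q : (W.baseChange (ringClassField K ι 1)).toAffine.Point, ((2 ^ M₀ : ℕ) : ℤ) • Q = d₁.derivedPoint) ∧
            (¬ ∃ Q : (W.baseChange (ringClassField K ι 1)).toAffine.Point, ((2 ^ (M₀ + 1) : ℕ) : ℤ) • Q = d₁.derivedPoint)) ∧
          ∃ (Wd : WeierstrassCurve ℚ) (_ : Wd.IsElliptic) (_ : Wd.IsGloballyMinimal),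
            (∃ C : VariableChange ℚ, C • W.quadraticTwist (NumberField.discr K : ℚ) = Wd) ∧ Nat.card (Wd.selmerGroup 2) = 1 ∧
            ((W.Δ < 0 ∧ padicValNat 2 Wd.tamagawaProduct ≤ 1) ∨ padicValNat 2 Wd.tamagawaProduct = 0))
    (hS2p : ∀ (W : WeierstrassCurve ℚ) [W.IsElliptic] [W.IsGloballyMinimal] [NeZero (W.conductorNorm ℤ)],
      ¬ W.HasCM → W.analyticRank = 1 → Nat.card (W.selmerGroup 2) = 2 → W.Δ < 0 → padicValNat 2 W.tamagawaProduct = 1 →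
      ∃ (K : Type) (_ : Field K) (_ : NumberField K),
        IsImaginaryQuadratic K ∧ (∃ ℓ : ℕ, ℓ.Prime ∧ NumberField.discr K = -(ℓ : ℤ)) ∧ Odd (NumberField.discr K) ∧
        NumberField.discr K ≠ -3 ∧ SatisfiesHeegnerHypothesis (W.conductorNorm ℤ) K ∧
        ∃ (Dt : ModularParametrizationData W (W.conductorNorm ℤ)) (β : ℤ) (ι : K →+* ℂ) (d₁ : KolyvaginHeegnerData Dt β ι 1),
          Dt.c ≠ 0 ∧ ¬ IsOfFinAddOrder d₁.derivedPoint ∧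
          (∃ Q : (W.baseChange (ringClassField K ι 1)).toAffine.Point,
            ((2 ^ (padicValInt 2 Dt.c + 1) : ℕ) : ℤ) • Q = d₁.derivedPoint) ∧
          (¬ ∃ Q : (W.baseChange (ringClassField K ι 1)).toAffine.Point,
            ((2 ^ (padicValInt 2 Dt.c + 1 + 1) : ℕ) : ℤ) • Q = d₁.derivedPoint) ∧
          ∃ (Wd : WeierstrassCurve ℚ) (_ : Wd.IsElliptic) (_ : Wd.IsGloballyMinimal),
            (∃ C : WeierstrassCurve.VariableChange ℚ, C • W.quadraticTwist (NumberField.discr K : ℚ) = Wd) ∧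
            Nat.card (Wd.selmerGroup 2) = 1)
    (hSid : RankOneAtTwoBigImageIdLocus)
    (hL : EntireLFunctionRat)
    (hGZ : GrossZagierAllLevels) (hGZK : MultPublishedInputsAtTwo) (hMi : MilneAnyModel) :
    NonCMAtTwo :=
  nonCMAtTwo_of_items_of_slicedWall_of_reversedSuppliesEgg_of_idLocus_line25 hP hPG hQ1 hQ2 hQ5R hQ3RT hQ4T hGf hR hOff hK1P hK1N hSha1
    hS1pos hS1neg hS2egg hS2p hSid hL hGZ hGZK hMi

/-- **`closes` (rev 57) ⟸ items + S1⁺ + S1⁻ + NV⁺ + EXP⁺ + NV⁻ + EXP⁻ + item 32821 + PRINT (+ modular parametrisation), BY NAME** —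
p773745's `nonCMAtTwo_of_items_of_slicedWall_of_nonvanishing_of_exponent_of_idLocus_line25` with `hSid := RankOneAtTwoBigImageIdLocus`.  The NET of
this seat's gen in one signature: inside the consumed cells U₂ = WALL(2 cells) + pure central-value statements NV± + 2-adic exponents EXP± (lossless)
+ the sibling route's item.  CONDITIONAL on the displayed hypotheses; proves nothing about BSD by itself; closes no item.
[cite: GrossZagier1986, Thm. I.6.3, V.§2 (2.2)] [cite: BCDTJAMS2001, Thm. A] [cite: MazurRubin2010, Cor. 3.4 (i)] [cite: Kramer1981, §2 Props. 3, 6]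
[cite: Miller2011LMS, Def. 1.1] -/
theorem nonCMAtTwo_of_items_of_slicedWall_of_nonvanishing_of_exponent_of_rankOneAtTwoBigImageIdLocus_line25
    (hP : GenusPrimitiveSupplyAtTwoPosDiscShallow) (hPG : GenusDeepSupplyAtTwoNegDiscNarrow) (hQ1 : CyclicTorsionOfNegDisc)
    (hQ2 : KolyvaginRelationAtTwo)
    (hQ5R : EquivariantChebotarevAtTwoR) (hQ3RT : EquivariantKolyvaginExactAtTwoRT)
    (hQ4T : KolyvaginExactAtTwoPosDiscT) (hGf : ExactDescentAtTwoOfFourFacts)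
    (hR : OffHabitatResidualAtTwo) (hOff : OffCutResidualAtTwoR)
    (hK1P : K1Pos) (hK1N : K1Neg) (hSha1 : ShaVanishingAtDepthZeroAtTwo)
    (hS1pos : ∀ (W : WeierstrassCurve ℚ) [W.IsElliptic] [W.IsGloballyMinimal],
      ¬ W.HasCM → W.analyticRank = 0 → Nat.card (W.selmerGroup 2) = 1 → 0 < W.Δ → padicValNat 2 W.tamagawaProduct = 0 → BSDp W 2)
    (hS1neg : ∀ (W : WeierstrassCurve ℚ) [W.IsElliptic] [W.IsGloballyMinimal],
      ¬ W.HasCM → W.analyticRank = 0 → Nat.card (W.selmerGroup 2) = 1 → W.Δ < 0 → padicValNat 2 W.tamagawaProduct = 2 → BSDp W 2)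
    (hNVpos : ∀ (W : WeierstrassCurve ℚ) [W.IsElliptic] [W.IsGloballyMinimal] [NeZero (W.conductorNorm ℤ)],
      ¬ W.HasCM → W.analyticRank = 1 → Nat.card (W.selmerGroup 2) = 2 → Odd W.tamagawaProduct → W.HasSurjectiveModNGaloisRep 2 →
      0 < W.Δ → MeetsEgg W →
      ∃ (K : Type) (_ : Field K) (_ : NumberField K),
        IsImaginaryQuadratic K ∧
        (∃ ℓ : ℕ, ℓ.Prime ∧ NumberField.discr K = -(ℓ : ℤ) ∧
          ∀ x : ZMod ℓ, 4 * x ^ 3 + ((integralModelInt W).b₂ : ZMod ℓ) * x ^ 2 +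
            2 * ((integralModelInt W).b₄ : ZMod ℓ) * x + ((integralModelInt W).b₆ : ZMod ℓ) ≠ 0) ∧
        Odd (NumberField.discr K) ∧ NumberField.discr K ≠ -3 ∧ SatisfiesHeegnerHypothesis (W.conductorNorm ℤ) K ∧
        (W.quadraticTwist (NumberField.discr K : ℚ)).entireLFunction 1 ≠ 0)
    (hEXPpos : ∀ (W : WeierstrassCurve ℚ) [W.IsElliptic] [W.IsGloballyMinimal] [NeZero (W.conductorNorm ℤ)],
      ¬ W.HasCM → W.analyticRank = 1 → Nat.card (W.selmerGroup 2) = 2 → Odd W.tamagawaProduct → W.HasSurjectiveModNGaloisRep 2 →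
      0 < W.Δ → MeetsEgg W →
      ∀ (K : Type) [Field K] [NumberField K], IsImaginaryQuadratic K →
        ∀ (ℓ : ℕ), ℓ.Prime → NumberField.discr K = -(ℓ : ℤ) →
        (∀ x : ZMod ℓ, 4 * x ^ 3 + ((integralModelInt W).b₂ : ZMod ℓ) * x ^ 2 +
            2 * ((integralModelInt W).b₄ : ZMod ℓ) * x + ((integralModelInt W).b₆ : ZMod ℓ) ≠ 0) →
        Odd (NumberField.discr K) → NumberField.discr K ≠ -3 → SatisfiesHeegnerHypothesis (W.conductorNorm ℤ) K →
        (W.quadraticTwist (NumberField.discr K : ℚ)).entireLFunction 1 ≠ 0 →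
        ∀ (Dt : ModularParametrizationData W (W.conductorNorm ℤ)) (β : ℤ) (ι : K →+* ℂ) (d₁ : KolyvaginHeegnerData Dt β ι 1),
          ∃ M₀ : ℕ, padicValInt 2 Dt.c = M₀ ∧
            (∃ Q : (W.baseChange (ringClassField K ι 1)).toAffine.Point, ((2 ^ M₀ : ℕ) : ℤ) • Q = d₁.derivedPoint) ∧
            (¬ ∃ Q : (W.baseChange (ringClassField K ι 1)).toAffine.Point, ((2 ^ (M₀ + 1) : ℕ) : ℤ) • Q = d₁.derivedPoint))
    (hNVneg : ∀ (W : WeierstrassCurve ℚ) [W.IsElliptic] [W.IsGloballyMinimal] [NeZero (W.conductorNorm ℤ)],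
      ¬ W.HasCM → W.analyticRank = 1 → Nat.card (W.selmerGroup 2) = 2 → W.Δ < 0 → padicValNat 2 W.tamagawaProduct = 1 →
      ∃ (K : Type) (_ : Field K) (_ : NumberField K),
        IsImaginaryQuadratic K ∧
        (∃ (ℓ : ℕ) (_ : Fact ℓ.Prime), NumberField.discr K = -(ℓ : ℤ) ∧
          ¬ W.selmerGroup 2 ≤ MazurRubin2010.strictLocalKer W ℚ_[ℓ] 2) ∧
        Odd (NumberField.discr K) ∧ NumberField.discr K ≠ -3 ∧ SatisfiesHeegnerHypothesis (W.conductorNorm ℤ) K ∧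
        ((Ideal.span {(2 : ℤ)}).primesOver (𝓞 K)).ncard = 2 ∧
        (W.quadraticTwist (NumberField.discr K : ℚ)).entireLFunction 1 ≠ 0)
    (hEXPneg : ∀ (W : WeierstrassCurve ℚ) [W.IsElliptic] [W.IsGloballyMinimal] [NeZero (W.conductorNorm ℤ)],
      ¬ W.HasCM → W.analyticRank = 1 → Nat.card (W.selmerGroup 2) = 2 → W.Δ < 0 → padicValNat 2 W.tamagawaProduct = 1 →
      ∀ (K : Type) [Field K] [NumberField K], IsImaginaryQuadratic K →
        ∀ (ℓ : ℕ) [Fact ℓ.Prime], NumberField.discr K = -(ℓ : ℤ) → ¬ W.selmerGroup 2 ≤ MazurRubin2010.strictLocalKer W ℚ_[ℓ] 2 →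
        Odd (NumberField.discr K) → NumberField.discr K ≠ -3 → SatisfiesHeegnerHypothesis (W.conductorNorm ℤ) K →
        ((Ideal.span {(2 : ℤ)}).primesOver (𝓞 K)).ncard = 2 →
        (W.quadraticTwist (NumberField.discr K : ℚ)).entireLFunction 1 ≠ 0 →
        ∀ (Dt : ModularParametrizationData W (W.conductorNorm ℤ)) (β : ℤ) (ι : K →+* ℂ) (d₁ : KolyvaginHeegnerData Dt β ι 1),
          (∃ Q : (W.baseChange (ringClassField K ι 1)).toAffine.Point,
            ((2 ^ (padicValInt 2 Dt.c + 1) : ℕ) : ℤ) • Q = d₁.derivedPoint) ∧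
          (¬ ∃ Q : (W.baseChange (ringClassField K ι 1)).toAffine.Point,
            ((2 ^ (padicValInt 2 Dt.c + 1 + 1) : ℕ) : ℤ) • Q = d₁.derivedPoint))
    (hSid : RankOneAtTwoBigImageIdLocus)
    (hMP : nonempty_modularParametrizationData)
    (hL : EntireLFunctionRat)
    (hGZ : GrossZagierAllLevels) (hGZK : MultPublishedInputsAtTwo) (hMi : MilneAnyModel) :
    NonCMAtTwo :=
  nonCMAtTwo_of_items_of_slicedWall_of_nonvanishing_of_exponent_of_idLocus_line25 hP hPG hQ1 hQ2 hQ5R hQ3RT hQ4T hGf hR hOff hK1P hK1N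
    hSha1 hS1pos hS1neg hNVpos hEXPpos hNVneg hEXPneg hSid hMP hL hGZ hGZK hMi

end Summit.BirchSwinnertonDyer.BirchSwinnertonDyer.Theorems.GenusExact.TwinSwap.Ledger.Line25

end
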